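import Mathlib
import HarnessLib
import Summits.Ventures.LatticeQCDFlow.Exactness.SUNForceRegularity
import Summits.Ventures.LatticeQCDFlow.Exactness.SUNWilsonHMCForce
import Summits.Ventures.LatticeQCDFlow.Scoring.WilsonStapleSum

/-!
# The engine's `SU(N)` Wilson force as a smooth AMBIENT LAW of the link matrices — adapter to the tree's `sunWilsonForce`: the multi-step leapfrog HMC AS RUN converges to the Wilson measure for short trajectories by the `C¹` route

HONEST FRAMING: exact (Metropolis-corrected) sampling algorithms for lattice gauge theory;
figures of merit are autocorrelation/cost numbers at stated couplings and volumes; no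
continuum-physics claim.

Venture `LatticeQCDFlow` (cell pub-lqcd), topic `Exactness`, FANOUT row 9 (eng-latcore, the
engine `latflow.core`: `hmc.HMC(f, β, 'leapfrog').trajectory(τ, nstep)` on the torus `(ℤ/L)^d` with
`G = SU(N)`; reading `hmc.py` l.7 and `gauge4d.GaugeField.force_ref` / `action` / `sun.TA`:
action `S(U) = β Σ_p (1 − Re tr U_p / N)`, momenta `P_e ∈ 𝔰𝔲(N)`, kinetic term `−tr P²`, half kicks
`P ← P − c·F(U)` with **`F(U)_e = (β/2N)·TA(U_e R_e(U))`**, `TA(M) = (M − M†)/2 − tr((M − M†)/2)/N·1`,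
`R_e` the staple sum, drifts `U_e ← exp(εP_e) U_e`, Metropolis test).  ADAPTER (cell lead ruling RR-15 (55),
INBOX l.5518): the tree's `SU(N)` Wilson HMC force OF RECORD is row 21's `SUNWilsonHMCForce.sunWilsonForce N β U`
(`= (β/2)·coordOf(P(Ω_e(U)))` for the action `β·wilsonAction (suRep N)`, WITH explicit volume-independent sup and
Lipschitz constants; its sequel `SUNWilsonHMCErgodic.lean` proves the as-run convergence with ONE threshold
`sunWilsonTrajThreshold N d β` for all `L`).  This file keeps row 9's complementary content and imports row 21's
declarations instead of re-declaring them: the force as the restriction of a SMOOTH AMBIENT LAW on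
`links → M_N(ℂ)` (the input of the `C¹` route `SUNForceRegularity.lean`, which needs no constant), the bridge
to `sunWilsonForce` (engine coupling `β_eng` ↔ the tree's `β = β_eng/N`), the staple form of the force matrix
(`gauge4d.force_ref` to the letter) and its identification with the Literature Wilson-flow velocity, and the
per-volume convergence theorem of the engine's HMC as run obtained from the `C¹` route.  NEW WORK of the cell
over the tree (`SUNForceRegularity.lean`; row 21's `SUNWilsonHMCForce.lean`: `sunWilsonForce`,
`sunCoordι_sunWilsonForce`, `norm_sunWilsonForce_le` / `_sub_le`, `sunWilsonForceSup` / `Lip`;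
`SUNKickCoordinates.lean` / `SUNExpChart.lean`: `sunCoordι`, `coordOf`, `sunCoordι_range`; row 16's
`Scoring/WilsonStapleSum.lean`: `stapleSum`, `plaquetteLoopSum_eq_mul_stapleSum`; `SUNLeapfrogHMCWilson.lean`:
`β S_W` bounded, its Gibbs law is the Literature Wilson measure).  The Literature's torus Wilson theory and
Wilson flow (`QuantumFieldTheory/ConstructiveQFTWave0`, `QuantumFieldTheory/WilsonFlow`: `wilsonAction`,
`wilsonMeasure`, the projection `suProj` = the engine's `TA`, `plaquetteLoopSum = Ω_{x,μ}`, its ambient form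
`loopSumAmb`, the flow velocity `wilsonFlowVF = −P(Ω)V`) are USED BY NAME; nothing is cited as a fact and no
number is claimed.

* §1 **`sunWilsonForceLaw N β`** — the ambient law `W ↦ (coordOf ((β/2N)·P(Ω_e(W))))_e` on
  `links → M_N(ℂ)` (adjoints in place of inverses; `β` = the ENGINE's coupling);
  **`sunWilsonForceLaw_coeConfig`** — THE BRIDGE: on configurations it is row 21's force,
  `sunWilsonForceLaw N β (coeConfig U) e = sunWilsonForce N (β/N) U e` (+ the function form `_eq`);
  `sunCoordι_sunWilsonForceLaw_coeConfig` (`ι F(U)_e = (β/2N)·TA(Ω_e(U))`),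
  **`sunCoordι_sunWilsonForce_eq_staple`** (row 21's force matrix `= (β/2)·TA(U_e R_e(U))` with row 16's
  staple-sum matrix — `gauge4d.force(coef)` to the letter, `coef = β/2 = β_eng/(2N)`),
  **`sunCoordι_sunWilsonForce_mul_eq_wilsonFlowVF`** (`ι F(U)_e · U_e = −(β/2)·Z(U)_e`: the HMC force is a
  multiple of the Literature Wilson-flow velocity right-translated to the identity — the engine's own remark
  "HMC: coef = β/(2N); flow Z: coef = −1").
* §2 `contDiff_sunWilsonForceLaw` (a polynomial in the link matrices and their adjoints composed with linear
  maps, in the matrix sup norm of the HMC files), `measurable_sunWilsonForceLaw_coeConfig`,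
  `sunWilsonForceLaw_bounds` (bounded per link AND Lipschitz — SOME constants, by the `C¹` route) and
  `sunWilsonForceLaw_bounds_explicit` (the same with row 21's explicit constants, through the bridge).
* §3 **`wilson_sunWilsonForceHMCN_uniformlyErgodic`** — THE ENGINE'S `SU(N)` HMC AS RUN, PER VOLUME, BY THE
  `C¹` ROUTE: for every `N ≥ 1`, `d`, `L ≥ 1`, real `β` there is `τ₀ > 0` such that for EVERY `n ≥ 1`, `ε > 0`
  with `nε ≤ τ₀` the `n`-step leapfrog HMC with half kick `−(ε/2)·F(U)`, `F(U) = sunWilsonForceLaw N β (coeConfig U)`,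
  the engine's momenta and kinetic term and the Metropolis test on `(β/N)·S_W + T` converges to
  `wilsonMeasure (fundamentalRep) (β/N)` (the law `∝ e^{−β Σ_p (1 − Re tr U_p/N)} · Haar^{⊗links}`) from EVERY
  initial law geometrically in total variation; **`wilsonMeasure_unique_invariant_sunWilsonForceHMCN`**;
  `wilson_sunWilsonForceHMC_trajectory_uniformlyErgodic` (the engine's parametrisation `trajectory(τ, nstep)`,
  `ε = τ/nstep`: every `0 < τ ≤ τ₀`, every `nstep ≥ 1`); **`sunLeapfrogHMCN_sunWilsonForceLaw_eq`** — the kernel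
  of these statements IS the kernel of row 21's statements at `β/N` (same Markov kernel; the two files'
  theorems are about one object).

NOT CLAIMED: any value of `τ₀` here (row 21's `SUNWilsonHMCErgodic.lean` has the volume-independent one —
import it for the `∀ L` statement; not restated); anything beyond the threshold (the engine's usual
`τ = nε ≈ 1` is NOT covered); that `F` is the gradient of `(β/N)·S_W` for the kinetic metric
(`SUNWilsonForceGradient.lean` proves the derivative identity along drifts); OMF2/OMF4 words (row 14);
`tau_jitter`; plaquette weights / defect boundary conditions; floating point (`expm_taylor`).
-/

noncomputable section


namespace Summit.Ventures.LatticeQCDFlow.Exactness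

open MeasureTheory ProbabilityTheory ProbabilityTheory.Kernel Set Metric Function
open Literature.MathematicalPhysics.QuantumFieldTheory
open Literature.MathematicalPhysics.QuantumLattice (fundamentalRep fundamentalRep_apply continuous_fundamentalRep)
open scoped ENNReal Matrix Matrix.Norms.Operator NNReal

set_option backward.isDefEq.respectTransparency false

/-! ## §1 The engine's Wilson force in coordinates -/

section Force

variable (N : ℕ) {d L : ℕ}

/-- **THE ENGINE'S WILSON FORCE LAW on the ambient algebra** `links → M_N(ℂ)`:
`P_β(W)_e = coordOf ((β/2N)·TA(Ω_e(W)))`, `Ω_e(W) = loopSumAmb W` the sum of the plaquette loops through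
`e` starting with `W_e` (adjoints in place of inverses), `TA = suProj`. -/
def sunWilsonForceLaw (β : ℝ) (W : GaugeConfig d L (Matrix (Fin N) (Fin N) ℂ)) : Edge d L → SUNCoords N :=
  fun e => coordOf (sunCoordι N) (sunCoordι_injective N)
    ((β / (2 * N)) • suProj (WilsonFlow.loopSumAmb W e.1 e.2))

/-- **THE BRIDGE.** On configurations the ambient law IS the tree's `SU(N)` Wilson HMC force of record
(row 21's `sunWilsonForce`), at the tree's coupling `β/N` for the engine's `β`:
`sunWilsonForceLaw N β (coeConfig U) e = sunWilsonForce N (β/N) U e`. -/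
theorem sunWilsonForceLaw_coeConfig (β : ℝ) (U : GaugeConfig d L (Matrix.specialUnitaryGroup (Fin N) ℂ))
    (e : Edge d L) : sunWilsonForceLaw N β (coeConfig U) e = sunWilsonForce N (β / N) U e := by
  -- `loopSumAmb (coeConfig U) = plaquetteLoopSum U` holds by `rfl` (the Literature's `loopSumAmb_coeConfig`)
  simp only [sunWilsonForceLaw, sunWilsonForce, LinearMap.map_smul]
  congr 1
  ring

/-- The bridge as an equality of force fields: `(U ↦ sunWilsonForceLaw N β (coeConfig U)) = sunWilsonForce N (β/N)`. -/
theorem sunWilsonForceLaw_coeConfig_eq (β : ℝ) :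
    (fun U : GaugeConfig d L (Matrix.specialUnitaryGroup (Fin N) ℂ) => sunWilsonForceLaw N β (coeConfig U)) =
      sunWilsonForce N (β / N) :=
  funext fun U => funext fun e => sunWilsonForceLaw_coeConfig N β U e

/-- `TA(M)` is a value of the engine's coordinates: `ι (coordOf (TA M)) = TA M` (`N ≥ 1`). -/
theorem sunCoordι_coordOf_suProj [NeZero N] (M : Matrix (Fin N) (Fin N) ℂ) :
    sunCoordι N (coordOf (sunCoordι N) (sunCoordι_injective N) (suProj M)) = suProj M := by
  obtain ⟨a, ha⟩ := sunCoordι_range N (suProj M) (conjTranspose_suProj M) (trace_suProj M)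
  rw [← ha, coordOf_apply]

/-- **The matrix of the ambient law on a configuration is `(β/2N)·TA(Ω_e(U))`.** -/
theorem sunCoordι_sunWilsonForceLaw_coeConfig [NeZero N] (β : ℝ)
    (U : GaugeConfig d L (Matrix.specialUnitaryGroup (Fin N) ℂ)) (e : Edge d L) :
    sunCoordι N (sunWilsonForceLaw N β (coeConfig U) e) = (β / (2 * N)) • suProj (plaquetteLoopSum U e.1 e.2) := by
  rw [sunWilsonForceLaw, LinearMap.map_smul, LinearMap.map_smul, sunCoordι_coordOf_suProj,
    ← WilsonFlow.loopSumAmb_coeConfig]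
  rfl

/-- **The tree's force matrix is the engine's `coef·TA(U_e R_e(U))`** with row 16's staple-sum matrix in the
defining representation (`gauge4d.force_ref`: `F[mu] = coef * TA(U[mu] @ staples)`, `coef = β_eng/(2N) = β/2`). -/
theorem sunCoordι_sunWilsonForce_eq_staple (β : ℝ)
    (U : GaugeConfig d L (Matrix.specialUnitaryGroup (Fin N) ℂ)) (e : Edge d L) :
    sunCoordι N (sunWilsonForce N β U e) =
      (β / 2) • suProj (((U e : Matrix.specialUnitaryGroup (Fin N) ℂ) : Matrix (Fin N) (Fin N) ℂ) *
        Scoring.stapleSum (fundamentalRep (Fin N)) U e.1 e.2) := by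
  rw [sunCoordι_sunWilsonForce, Scoring.plaquetteLoopSum_eq_mul_stapleSum]

/-- **The HMC force is `−β/2` times the Wilson-flow velocity**, right-translated to the identity:
`ι F(U)_e · U_e = −(β/2)·Z(U)_e` with the Literature's `wilsonFlowVF U e = −TA(Ω_e(U))·U_e`. -/
theorem sunCoordι_sunWilsonForce_mul_eq_wilsonFlowVF (β : ℝ)
    (U : GaugeConfig d L (Matrix.specialUnitaryGroup (Fin N) ℂ)) (e : Edge d L) :
    sunCoordι N (sunWilsonForce N β U e) * ((U e : Matrix.specialUnitaryGroup (Fin N) ℂ) : Matrix (Fin N) (Fin N) ℂ) =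
      (-(β / 2)) • wilsonFlowVF U e := by
  rw [sunCoordι_sunWilsonForce, wilsonFlowVF, Matrix.smul_mul, neg_mul, smul_neg, neg_smul, neg_neg]

end Force

/-! ## §2 Regularity: smooth, measurable, bounded and Lipschitz in the matrix sup norm -/

section Regular

variable (N : ℕ) {d L : ℕ} [NeZero L]

/-- The Wilson force law is smooth: a polynomial in the link matrices and their adjoints composed with the
linear maps `TA` and `coordOf` (in the matrix sup norm of the HMC files). -/
theorem contDiff_sunWilsonForceLaw (β : ℝ) {m : WithTop ℕ∞} :
    ContDiff ℝ m (sunWilsonForceLaw N (d := d) (L := L) β) := by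
  -- conjugate transposition and the trace as real-linear continuous maps of `M_N(ℂ)`
  have hCT : ContDiff ℝ m fun M : Matrix (Fin N) (Fin N) ℂ => Mᴴ :=
    (LinearMap.toContinuousLinearMap
      ({ toFun := fun M => Mᴴ
         map_add' := fun M M' => Matrix.conjTranspose_add M M'
         map_smul' := fun c M => by rw [Matrix.conjTranspose_smul, star_trivial]; rfl } :
        Matrix (Fin N) (Fin N) ℂ →ₗ[ℝ] Matrix (Fin N) (Fin N) ℂ)).contDiff
  have hTR : ContDiff ℝ m fun M : Matrix (Fin N) (Fin N) ℂ => M.trace :=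
    (LinearMap.toContinuousLinearMap (Matrix.traceLinearMap (Fin N) ℝ ℂ)).contDiff
  have hP : ContDiff ℝ m (suProj (n := N)) := by
    have h1 : ContDiff ℝ m fun M : Matrix (Fin N) (Fin N) ℂ => M - Mᴴ := contDiff_id.sub hCT
    exact (h1.const_smul (1 / 2 : ℂ)).sub (((hTR.comp h1).const_smul (1 / (2 * N) : ℂ)).smul contDiff_const)
  -- links and their adjoints as functions of the ambient configuration
  have hev : ∀ e : Edge d L, ContDiff ℝ m fun W : GaugeConfig d L (Matrix (Fin N) (Fin N) ℂ) => W e :=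
    fun e => contDiff_apply ℝ (Matrix (Fin N) (Fin N) ℂ) e
  have hct : ∀ e : Edge d L, ContDiff ℝ m fun W : GaugeConfig d L (Matrix (Fin N) (Fin N) ℂ) => (W e)ᴴ :=
    fun e => hCT.comp (hev e)
  have hΩ : ∀ (x : Site d L) (μ : Fin d),
      ContDiff ℝ m fun W : GaugeConfig d L (Matrix (Fin N) (Fin N) ℂ) => WilsonFlow.loopSumAmb W x μ := by
    intro x μ
    unfold WilsonFlow.loopSumAmb
    refine ContDiff.sum fun ν _ => ?_
    by_cases h : ν = μ
    · simp only [h, if_true]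
      exact contDiff_const
    · simp only [h, if_false]
      refine ContDiff.add ?_ ?_
      -- the edges are left to unification (`_`): the torus arithmetic `x - Pi.single ν 1` must be read off
      -- the goal, not re-elaborated here
      · exact (((hev _).mul (hev _)).mul (hct _)).mul (hct _)
      · exact ((hct _).mul ((((hev _).mul (hev _)).mul (hct _)).mul (hct _))).mul (hev _)
  refine contDiff_pi.2 fun e => ?_
  exact (LinearMap.toContinuousLinearMap (coordOf (sunCoordι N) (sunCoordι_injective N))).contDiff.comp
    ((hP.comp (hΩ e.1 e.2)).const_smul _)

/-- The restriction of the law to configurations is measurable (the `C¹` route's measurability term, the one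
the kernels of §3 are built with). -/
theorem measurable_sunWilsonForceLaw_coeConfig (β : ℝ) :
    Measurable fun U : GaugeConfig d L (Matrix.specialUnitaryGroup (Fin N) ℂ) => sunWilsonForceLaw N β (coeConfig U) :=
  measurable_sunForce_of_continuous _ (contDiff_sunWilsonForceLaw N β (m := 1)).continuous

/-- **The restricted law is bounded per link and Lipschitz in the matrix sup norm** — SOME constants, by the
`C¹` route (`SUNForceRegularity.sunForce_bounds_of_contDiff`; nothing computed). -/
theorem sunWilsonForceLaw_bounds (β : ℝ) :
    ∃ Fmax KF : ℝ, 0 ≤ Fmax ∧ 0 ≤ KF ∧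
      (∀ (U : GaugeConfig d L (Matrix.specialUnitaryGroup (Fin N) ℂ)) (e : Edge d L),
        ‖sunWilsonForceLaw N β (coeConfig U) e‖ ≤ Fmax) ∧
      ∀ U U' : GaugeConfig d L (Matrix.specialUnitaryGroup (Fin N) ℂ),
        ‖sunWilsonForceLaw N β (coeConfig U) - sunWilsonForceLaw N β (coeConfig U')‖ ≤ KF * ‖coeConfig U - coeConfig U'‖ :=
  sunForce_bounds_of_contDiff _ (contDiff_sunWilsonForceLaw N β)

/-- **The same bounds with row 21's EXPLICIT, volume-independent constants**, through the bridge: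
`‖F(U)_e‖ ≤ sunWilsonForceSup N d (β/N)` and `‖F(U) − F(U')‖ ≤ sunWilsonForceLip N d (β/N) · ‖U − U'‖`. -/
theorem sunWilsonForceLaw_bounds_explicit [NeZero N] (β : ℝ) :
    (∀ (U : GaugeConfig d L (Matrix.specialUnitaryGroup (Fin N) ℂ)) (e : Edge d L),
        ‖sunWilsonForceLaw N β (coeConfig U) e‖ ≤ sunWilsonForceSup N d (β / N)) ∧
      ∀ U U' : GaugeConfig d L (Matrix.specialUnitaryGroup (Fin N) ℂ),
        ‖sunWilsonForceLaw N β (coeConfig U) - sunWilsonForceLaw N β (coeConfig U')‖ ≤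
          sunWilsonForceLip N d (β / N) * ‖coeConfig U - coeConfig U'‖ := by
  refine ⟨fun U e => ?_, fun U U' => ?_⟩
  · rw [sunWilsonForceLaw_coeConfig]
    exact norm_sunWilsonForce_le N (β / N) U e
  · have h := sunWilsonForceLaw_coeConfig_eq N (d := d) (L := L) β
    have hU : sunWilsonForceLaw N β (coeConfig U) = sunWilsonForce N (β / N) U := congrFun h U
    have hU' : sunWilsonForceLaw N β (coeConfig U') = sunWilsonForce N (β / N) U' := congrFun h U'
    rw [hU, hU']
    exact norm_sunWilsonForce_sub_le N (β / N) U U'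

end Regular

/-! ## §3 The engine's `SU(N)` HMC as run converges to the Wilson measure for short trajectories -/

section Wilson

variable (N : ℕ) [NeZero N] {d L : ℕ} [NeZero L]

omit [NeZero N] in
/-- The engine's action `(β/N)·S_W` is measurable. -/
theorem measurable_engineWilsonAction (β : ℝ) :
    Measurable fun U : GaugeConfig d L (Matrix.specialUnitaryGroup (Fin N) ℂ) => β / N * wilsonAction (fundamentalRep (Fin N)) U :=
  (continuous_smul_wilsonAction (fundamentalRep (Fin N)) (continuous_fundamentalRep (Fin N)) (β / N)).measurable

/-- **THE ENGINE'S `SU(N)` LEAPFROG HMC AS RUN CONVERGES TO THE WILSON MEASURE FOR SHORT TRAJECTORIES.**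
Torus `(ℤ/L)^d`, `G = SU(N)` (`N, L ≥ 1`), any real `β`; action `(β/N)·S_W = β Σ_p (1 − Re tr U_p/N)`,
the engine's momenta (coordinates `sunCoordι N`, kinetic term `−Σ tr P²`, Gaussian refresh), `n`
P-first leapfrog steps of size `ε` with half kicks by THE ENGINE'S FORCE `(β/2N)·TA(U_e R_e(U))`
(`= sunWilsonForceLaw N β (coeConfig U)`, the `C¹` route; `= sunWilsonForce N (β/N) U` by the bridge),
Metropolis test.  There is `τ₀ > 0` (depending on `N, d, L, β` only; not computed) such that for EVERY
`n ≥ 1` and `ε > 0` with `nε ≤ τ₀` there are `k` and `δ ∈ (0, 1]` with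
`|μ₀Kᵗ(A) − wilsonMeasure (β/N) (A)| ≤ (1 − δ)^{⌊t/(k+1)⌋}` for EVERY initial law `μ₀`, every `t`, `A`. -/
theorem wilson_sunWilsonForceHMCN_uniformlyErgodic (β : ℝ) :
    ∃ τ₀ : ℝ, 0 < τ₀ ∧ ∀ (nstep : ℕ) (ε : ℝ) (hn : 1 ≤ nstep) (hε : 0 < ε), nstep * ε ≤ τ₀ →
      ∃ k : ℕ, ∃ δ : ℝ, 0 < δ ∧ δ ≤ 1 ∧
        ∀ (μ₀ : Measure (GaugeConfig d L (Matrix.specialUnitaryGroup (Fin N) ℂ))) [IsProbabilityMeasure μ₀]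
          (t : ℕ) (A : Set (GaugeConfig d L (Matrix.specialUnitaryGroup (Fin N) ℂ))),
          |((fun m : Measure (GaugeConfig d L (Matrix.specialUnitaryGroup (Fin N) ℂ)) =>
                m.bind (sunLeapfrogHMCN (sunCoordι N) (sunCoordι_skew N) ε (Measure.addHaar : Measure (SUNCoords N))
                  (sunKinetic N) (measurable_halfKick_sun N (measurable_sunWilsonForceLaw_coeConfig N (d := d) (L := L) β) ε)
                  (fun U => β / N * wilsonAction (fundamentalRep (Fin N)) U) nstep))^[t] μ₀).real A
              - (wilsonMeasure (d := d) (L := L) (fundamentalRep (Fin N)) (β / N)).real A| ≤ (1 - δ) ^ (t / (k + 1)) := by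
  obtain ⟨s, hs⟩ := exists_bound_smul_wilsonAction_sun N (d := d) (L := L) (fundamentalRep (Fin N))
    (continuous_fundamentalRep (Fin N)) (β / N)
  rw [← gibbsProbability_smul_wilsonAction_eq N (d := d) (L := L) (fundamentalRep (Fin N)) (β / N)]
  exact engine_sunLeapfrogHMCN_uniformlyErgodic_of_contDiff N (sunWilsonForceLaw N β)
    (contDiff_sunWilsonForceLaw N β) (measurable_engineWilsonAction N β) hs

/-- **The Wilson measure is the unique invariant probability law of the engine's `SU(N)` HMC as run**,
for short trajectories (`nε ≤ τ₀`). -/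
theorem wilsonMeasure_unique_invariant_sunWilsonForceHMCN (β : ℝ) :
    ∃ τ₀ : ℝ, 0 < τ₀ ∧ ∀ (nstep : ℕ) (ε : ℝ) (hn : 1 ≤ nstep) (hε : 0 < ε), nstep * ε ≤ τ₀ →
      ∀ (π' : Measure (GaugeConfig d L (Matrix.specialUnitaryGroup (Fin N) ℂ))), IsProbabilityMeasure π' →
        Invariant (sunLeapfrogHMCN (sunCoordι N) (sunCoordι_skew N) ε (Measure.addHaar : Measure (SUNCoords N))
          (sunKinetic N) (measurable_halfKick_sun N (measurable_sunWilsonForceLaw_coeConfig N (d := d) (L := L) β) ε)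
          (fun U => β / N * wilsonAction (fundamentalRep (Fin N)) U) nstep) π' →
        π' = wilsonMeasure (d := d) (L := L) (fundamentalRep (Fin N)) (β / N) := by
  obtain ⟨s, hs⟩ := exists_bound_smul_wilsonAction_sun N (d := d) (L := L) (fundamentalRep (Fin N))
    (continuous_fundamentalRep (Fin N)) (β / N)
  obtain ⟨τ₀, hτ₀, h⟩ := engine_sunLeapfrogHMCN_invariant_unique_of_contDiff N (sunWilsonForceLaw N β)
    (contDiff_sunWilsonForceLaw N β) (measurable_engineWilsonAction N β) hs
  refine ⟨τ₀, hτ₀, fun nstep ε hn hε hτ π' hπ' hinv => ?_⟩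
  rw [← gibbsProbability_smul_wilsonAction_eq N (d := d) (L := L) (fundamentalRep (Fin N)) (β / N)]
  exact h nstep ε hn hε hτ π' hπ' hinv

/-- **The same in the engine's parametrisation `trajectory(τ, nstep)`** (`ε = τ/nstep`): there is `τ₀ > 0` such
that for EVERY trajectory length `0 < τ ≤ τ₀` and EVERY `nstep ≥ 1` the engine's `SU(N)` HMC as run converges
to the Wilson measure from every initial law, geometrically in total variation. -/
theorem wilson_sunWilsonForceHMC_trajectory_uniformlyErgodic (β : ℝ) :
    ∃ τ₀ : ℝ, 0 < τ₀ ∧ ∀ (τ : ℝ) (nstep : ℕ) (hτ : 0 < τ) (hτ₀ : τ ≤ τ₀) (hn : 1 ≤ nstep),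
      ∃ k : ℕ, ∃ δ : ℝ, 0 < δ ∧ δ ≤ 1 ∧
        ∀ (μ₀ : Measure (GaugeConfig d L (Matrix.specialUnitaryGroup (Fin N) ℂ))) [IsProbabilityMeasure μ₀]
          (t : ℕ) (A : Set (GaugeConfig d L (Matrix.specialUnitaryGroup (Fin N) ℂ))),
          |((fun m : Measure (GaugeConfig d L (Matrix.specialUnitaryGroup (Fin N) ℂ)) =>
                m.bind (sunLeapfrogHMCN (sunCoordι N) (sunCoordι_skew N) (τ / nstep) (Measure.addHaar : Measure (SUNCoords N))
                  (sunKinetic N) (measurable_halfKick_sun N (measurable_sunWilsonForceLaw_coeConfig N (d := d) (L := L) β) (τ / nstep))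
                  (fun U => β / N * wilsonAction (fundamentalRep (Fin N)) U) nstep))^[t] μ₀).real A
              - (wilsonMeasure (d := d) (L := L) (fundamentalRep (Fin N)) (β / N)).real A| ≤ (1 - δ) ^ (t / (k + 1)) := by
  obtain ⟨τ₀, hτ₀, h⟩ := wilson_sunWilsonForceHMCN_uniformlyErgodic N (d := d) (L := L) β
  refine ⟨τ₀, hτ₀, fun τ nstep hτ hττ₀ hn => h nstep (τ / nstep) hn (div_pos hτ (by exact_mod_cast hn)) ?_⟩
  have hn0 : (nstep : ℝ) ≠ 0 := by exact_mod_cast (Nat.one_le_iff_ne_zero.1 hn)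
  rwa [mul_div_cancel₀ _ hn0]

omit [NeZero N] in
/-- **One object, two files.** The kernel of the statements above (force term built from the `C¹` law) IS the
kernel of row 21's `SUNWilsonHMCErgodic` statements at the tree's coupling `β/N` (force term built from
`sunWilsonForce`): the two force fields are equal (`sunWilsonForceLaw_coeConfig_eq`) and the kernel depends on
the measurability certificate only through the field. -/
theorem sunLeapfrogHMCN_sunWilsonForceLaw_eq (β ε : ℝ)
    (S : GaugeConfig d L (Matrix.specialUnitaryGroup (Fin N) ℂ) → ℝ) (nstep : ℕ) :
    sunLeapfrogHMCN (sunCoordι N) (sunCoordι_skew N) ε (Measure.addHaar : Measure (SUNCoords N)) (sunKinetic N)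
        (measurable_halfKick_sun N (measurable_sunWilsonForceLaw_coeConfig N (d := d) (L := L) β) ε) S nstep =
      sunLeapfrogHMCN (sunCoordι N) (sunCoordι_skew N) ε (Measure.addHaar : Measure (SUNCoords N)) (sunKinetic N)
        (measurable_halfKick_sun N (measurable_sunWilsonForce N (d := d) (L := L) (β / N)) ε) S nstep := by
  have h := sunWilsonForceLaw_coeConfig_eq N (d := d) (L := L) β
  congr 1
  exact funext fun U => by rw [← h]

end Wilson

end Summit.Ventures.LatticeQCDFlow.Exactness
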